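import Summits.QuantumFields.GaugeBoot.Rows.KZL2rpD4CapWitB
import HarnessLib

/-!
# Gauge-boot / YM instrument: the integer WEIGHTS of the kz-L2-rp-4D cap boxes, `w_v = p^{m(v)} · q^{4 − m(v)}` (P-A5 STAGE 3, S3a′)

Cell `ym-instrument` (HOME `run/shared/lean/pub/ym-instrument/`), crew (a), seat `ym-instrument-boot-lean-1` (gen 4); planner work order
P-A5 STAGE 3 «LIMIT ∣ cap kernel replay» (boot-plan 2026-08-27T14:33:09Z, LEAD A-0826-82). The three R0 «LIMIT ∣ cap» certificate files of
record carry the per-variable boxes `|y_v| ≤ ρ^{m(v)}`, `ρ = p/q` (`2177/2500` at `β_std = 9/5`, `558/625` at `11/5`), `m(v) = |capWit v|`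
(the tree decoder `KZL2rpD4.capWitN` of `Rows/KZL2rpD4CapWitB`; histogram 0:42 1:40 2:819 3:675 4:9302, so `m ≤ 4`). The weighted window
kernel `Sparse.objective_boundW_of_le` (`Certificates/SparseReducedWindowBoundW`) wants the boxes as INTEGER weights relative to `w 0`:
this module defines `capLen v := |capWitN v|` and `capWeight p q v := p^{capLen v} · q^{4 − capLen v}` ON `ℕ` (the form the kernel walk
evaluates per variable), proves `capWeight p q 0 = q^4` (`capLen 0 = 0`, kernel) and the comparison
`(p/q)^{capLen v} ≤ capWeight p q v / capWeight p q 0` (equality when `capLen v ≤ 4`; for a hypothetical `capLen v > 4` the ℕ-subtraction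
makes the right side `p^m/q^4 ≥ p^m/q^m`, so the inequality is unconditional). Pure bookkeeping, `[folklore]`.

HONEST FRAMING (page 1 of every file of this cell): combinatorial DATA / arithmetic about the witness table; no bound on any lattice
expectation is certified here and nothing is summit-bearing; the boxes themselves are `BesselCapBoxesKZL2rp.abs_y_le_pow_capWit_b*` (tori)
and `BesselCapObjectsKZL2rpLIM.abs_yLim_le_pow_capWit_b*` (limit points).
-/

namespace Summit.QuantumFields.GaugeBoot

namespace KZL2rpD4

/-- **Number of witness links of column `v`**, `m(v) = |capWitN v|` (on `ℕ`; `0` beyond the table). [folklore] -/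
def capLen (v : ℕ) : ℕ := (capWitN v).length

/-- **The integer weight of column `v`**: `w_v = p^{m(v)} · q^{4 − m(v)}` (so that `w_v / w_0 = (p/q)^{m(v)}` when `m(v) ≤ 4`). [folklore] -/
def capWeight (p q : ℕ) (v : ℕ) : ℕ := p ^ capLen v * q ^ (4 - capLen v)

/-- `capLen` agrees with the length of `capWit` on the table's index type. [folklore] -/
theorem capLen_eq (v : Fin 10878) : capLen v.val = (capWit v).length := rfl

/-- The unit column has no witness links: `m(0) = 0` (kernel computation). [folklore] -/
theorem capLen_zero : capLen 0 = 0 := by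
  decide +kernel

/-- The plaquette column has one witness link: `m(1) = 1` (kernel computation; cf. `capWit_one`). [folklore] -/
theorem capLen_one : capLen 1 = 1 := by
  decide +kernel

/-- `w_0 = q^4`. [folklore] -/
theorem capWeight_zero (p q : ℕ) : capWeight p q 0 = q ^ 4 := by
  simp [capWeight, capLen_zero]

/-- `0 < w_0` for `0 < q`. [folklore] -/
theorem capWeight_zero_pos (p : ℕ) {q : ℕ} (hq : 0 < q) : 0 < capWeight p q 0 := by
  rw [capWeight_zero]; exact Nat.pow_pos hq

/-- Pure arithmetic: `(p/q)^m ≤ p^m · q^{4 − m} / q^4` for `0 < q` (equality if `m ≤ 4`). [folklore] -/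
theorem div_pow_le_pow_mul_pow_div (p : ℝ) {q : ℝ} (hp : 0 ≤ p) (hq : 1 ≤ q) (m : ℕ) :
    (p / q) ^ m ≤ p ^ m * q ^ (4 - m) / q ^ 4 := by
  have hq0 : 0 < q := lt_of_lt_of_le one_pos hq
  rw [div_pow]
  by_cases hm : m ≤ 4
  · have h4 : q ^ 4 = q ^ m * q ^ (4 - m) := by rw [← pow_add]; congr 1; omega
    rw [h4, mul_div_mul_right _ _ (pow_ne_zero _ hq0.ne')]
  · have h0 : 4 - m = 0 := by omega
    rw [h0, pow_zero, mul_one]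
    exact div_le_div_of_nonneg_left (pow_nonneg hp m) (pow_pos hq0 4) (pow_le_pow_right₀ hq (by omega))

/-- **The box in weight form**: `(p/q)^{m(v)} ≤ w_v / w_0` for `0 < q` (any `p`; equality whenever `m(v) ≤ 4`, i.e. on the whole table).
[folklore] -/
theorem div_pow_capLen_le_capWeight_div (p : ℕ) {q : ℕ} (hq : 0 < q) (v : ℕ) :
    ((p : ℝ) / q) ^ capLen v ≤ (capWeight p q v : ℝ) / (capWeight p q 0 : ℝ) := by
  rw [capWeight_zero, capWeight]
  push_cast
  exact div_pow_le_pow_mul_pow_div (p : ℝ) (Nat.cast_nonneg p) (by exact_mod_cast hq) (capLen v)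

/-- A box `|x| ≤ (p/q)^{|capWit v|}` gives the weight-form box `|x| ≤ w_v / w_0`. [folklore] -/
theorem abs_le_capWeight_div_of_abs_le_pow {x : ℝ} (p : ℕ) {q : ℕ} (hq : 0 < q) (v : Fin 10878)
    (h : |x| ≤ ((p : ℝ) / q) ^ (capWit v).length) :
    |x| ≤ (capWeight p q v.val : ℝ) / (capWeight p q 0 : ℝ) :=
  h.trans (by rw [← capLen_eq]; exact div_pow_capLen_le_capWeight_div p hq v.val)

end KZL2rpD4

end Summit.QuantumFields.GaugeBoot
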